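import Literature.MathematicalPhysics.QuantumFieldTheory.Balaban1983to89.B9SectBGpLettersY

/-!
# `Balaban1983to89.B9SectBParSelY` — T. Bałaban, *Propagators for lattice gauge theories in a background field*, Commun. Math. Phys. **99** (1985)
# 389–434 [Balaban1985BackgroundPropagators], (3.19)–(3.21) pp. 393–394 read at (3.35) p. 396: THE SELECTED AVERAGING TRANSPORTER OF A CODED
# CONFIGURATION (a proof device of the Sect.-B frame constructors; pub-ymgap N06 [B9], cure (α) of ⚑ LOCATED-29, module S0)

statement-level skeleton of published theorems with citation tags; proofs where landed; nothing here is a claim about the Yang–Mills mass gap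

THE PRINT.  (3.19) p. 393 «(Q′_j(U)λ)(y) = Σ_{x∈B^j(y)} L^{−jd} R(U(Γ^{(j)}_{y,x})) λ(x)» and (3.21) p. 394 define the averaging operators through
parallel transporters `U(Γ)` of the background field; (3.35) p. 396 «U … with values in G» is the class of configurations at which Sect. B
(pp. 400–407) uses them — every size `|R(U(Γ))| ≦ 1` behind (3.19)∕(3.24) is read AT SUCH configurations only.

WHY THIS FILE (pub-ymgap node N06 [B9]; director-ym №383 CASCADE-K, seat dag-n06-c; ⚑ LOCATED-29 and node00-def-Y's RULING (α) «guard the three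
displayed transporter laws by print's class»).  The Sect.-B frame constructors of the tree (`gpFrame₂CodedOn`, `cinvFrame₃CodedOn`, `gFrame₅CodedOn`, …)
display the averaging-transporter law `hpar : ∀ U, GVal G U → ∀ z w, par U z w ∈ G` AT EVERY `G`-valued configuration, because the root frame's
size fields `GpFrame₂.hkQ ∕ hsQ` are stated at every coded configuration; at B8's knit transporter `parKnitY` membership in `G` is a theorem only
on the (3.35)∕[5] (52) regime (`B9B8KnitLetterRegular.parKnitY_mem_of_pdev`).  THE DEVICE OF THIS FILE lets the constructors be re-threaded with
the law GUARDED, WITHOUT touching any frame structure or generic step theorem: the coded carrier (`B9SectBCodedCarrier.CCfg`: `base U ∣ mult a ∣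
prod U a`) remembers the BASE of a product, so a constructor may feed every letter the SELECTED transporter of the base,
  `parSelC G i par c := selY G i par (base of c)`,  `selY G i par U := if InRegY G i par U then par else parOneY i`,
  `InRegY G i par U := GVal G i U ∧ ∀ z w, par U z w ∈ G`  (constant-free; classical `if`; `parOneY` = the identity transporter):
the (3.19)∕(3.24) sizes then hold at EVERY coded configuration (§3: `kQC_norm_le_sel`, `sQC_norm_le_sel`), the selection is the same at `base U`
and at `prod U a` (definitionally), and wherever a frame field sits under (3.35) or under the coded class (3.37) the guarded law gives `InRegY`,
`selY = par` (`selY_of_inRegY`), and the landed proof terms apply verbatim.  Nothing of the device appears in any displayed Sect.-B statement.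

CONTENTS.  §1 `InRegY`, `parOneY`, `selY`, `parSelC` and their case lemmas; §2 membership and reversal of the selected transporter
(`selY_mem`, `parSelC_mem_base`, `selY_symm`, `parSelC_symm`); §3 the root frame's size fields at the selected transporter
(`kQC_norm_le_sel`, `sQC_norm_le_sel`).

HONEST SCOPE.  Definitions and three-line bookkeeping lemmas; no estimate of [B9] is proved or asserted; COUNT-NEUTRAL; N06 NOT discharged; one finite
lattice programme — nothing continuum ∕ OS ∕ mass-gap ∕ Clay.  Cell `pub-ymgap` (HUMAN RULING D-0062), Track A node N06 [B9], CASCADE-K (№383), cure (α)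
of LOCATED-29 (node00-def-Y ruling 2026-08-30), module S0.

RELATED IN THE TREE, NOT DUPLICATED: `B9SectBGpLettersY` (`GVal`, `kQC`, `sQC`, `wC`, `norm_kQY_le`, `norm_sQY_le`, `kQC_norm_le`, `sQC_norm_le`,
`norm_le_one_and_inv_of_mem`), `B9SectBCodedCarrier` (`CCfg`), `Node00` (`SiteParY`, `CfgY`) — USED BY NAME; no existing module modified.
-/

noncomputable section

namespace Literature.MathematicalPhysics.QuantumFieldTheory.Balaban1983to89.B9SectBParSelY

open Literature.MathematicalPhysics.QuantumFieldTheory.Balaban1983to89.B6KLevelCensusIndexV1 (KIdx)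
open Literature.MathematicalPhysics.QuantumFieldTheory.Balaban1983to89.B6Ineq2142KLevelV1 (β)
open Literature.MathematicalPhysics.QuantumFieldTheory.Balaban1983to89.B9SectBCodedCarrier (CCfg)
open Literature.MathematicalPhysics.QuantumFieldTheory.Balaban1983to89.B9Eq360DeltaPrimeAY (AfldY)
open Literature.MathematicalPhysics.QuantumFieldTheory.Balaban1983to89.B9SectBGpLettersY (GVal kQC sQC wC wC_nonneg norm_kQY_le norm_sQY_le
  norm_le_one_and_inv_of_mem)
open Literature.MathematicalPhysics.QuantumFieldTheory.Balaban1983to89.Node00 (SiteY IBondY CfgY SiteParY)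

variable {d ℓ : ℕ} {hd : 1 ≤ d + 1} {hL : Odd (ℓ + 1) ∧ 1 < ℓ + 1} {b₀ b₁ : ℝ}
variable {𝔸 : Type} [NormedRing 𝔸] [NormedAlgebra ℂ 𝔸] [CompleteSpace 𝔸]
variable (G : Subgroup 𝔸ˣ) (i : KIdx d ℓ hd hL b₀ b₁) (par : SiteParY 𝔸 i)

/-! ## §1 The selection -/

/-- **the regime of the selection at a configuration** (PROOF DEVICE, never a letter of record): `U` is `G`-valued AND the averaging transporters `par U` are `G`-valued — print's (3.35) reading of
(3.19)∕(3.21) («U … with values in G», so every `U(Γ)` is in `G`). [cite: Balaban1985BackgroundPropagators, (3.35) p.396, (3.21) p.394] -/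
def InRegY (U : CfgY 𝔸 i) : Prop := GVal G i U ∧ ∀ z w, par U z w ∈ G

/-- **the identity site transporter** `Γ ↦ 1` (the fallback of the selection off the regime; never the transporter of a Sect.-B step).
[cite: Balaban1985BackgroundPropagators, (3.21) p.394, bookkeeping] -/
def parOneY : SiteParY 𝔸 i := fun _ _ _ => 1

open Classical in
/-- **the selected transporter at a configuration** (PROOF DEVICE, never a letter of record — no displayed Sect.-B statement may be keyed to it): `par` itself on the regime `InRegY`, the identity transporter off it.
[cite: Balaban1985BackgroundPropagators, (3.21) p.394 read at (3.35) p.396] -/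
def selY (U : CfgY 𝔸 i) : SiteParY 𝔸 i := if InRegY G i par U then par else parOneY i

/-- **the selected transporter of a CODED configuration** (PROOF DEVICE, never a letter of record) — selected by its BASE: `base U ↦ selY U`, `prod U a ↦ selY U` (a coded product remembers its
base), `mult a ↦ par` (no letter of the frames reads a transporter at a bare multiplier). [cite: Balaban1985BackgroundPropagators, (3.21) p.394, (3.35)–(3.37) p.396, Thm 3.4 p.400 (the products `U′U`)] -/
def parSelC : CCfg (CfgY 𝔸 i) (AfldY 𝔸 i) → SiteParY 𝔸 i
  | .base U => selY G i par U
  | .mult _ => par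
  | .prod U _ => selY G i par U

/-- on the regime the selection is `par`. [cite: Balaban1985BackgroundPropagators, (3.35) p.396, bookkeeping] -/
theorem selY_of_inRegY {U : CfgY 𝔸 i} (h : InRegY G i par U) : selY G i par U = par := by
  classical
  exact if_pos h

/-- off the regime the selection is the identity transporter. [cite: Balaban1985BackgroundPropagators, (3.35) p.396, bookkeeping] -/
theorem selY_of_not_inRegY {U : CfgY 𝔸 i} (h : ¬ InRegY G i par U) : selY G i par U = parOneY i := by
  classical
  exact if_neg h

/-- at a base the coded selection is `selY` (definitional). [cite: Balaban1985BackgroundPropagators, (3.35) p.396, bookkeeping] -/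
@[simp] theorem parSelC_base (U : CfgY 𝔸 i) : parSelC G i par (.base U) = selY G i par U := rfl

/-- at a product the coded selection is `selY` OF THE BASE (definitional). [cite: Balaban1985BackgroundPropagators, Thm 3.4 p.400, bookkeeping] -/
@[simp] theorem parSelC_prod (U : CfgY 𝔸 i) (a : AfldY 𝔸 i) : parSelC G i par (.prod U a) = selY G i par U := rfl

/-- at a multiplier the coded selection is `par` (definitional). [cite: Balaban1985BackgroundPropagators, (3.37) p.396, bookkeeping] -/
@[simp] theorem parSelC_mult (a : AfldY 𝔸 i) : parSelC G i par (.mult a) = par := rfl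

/-- on the regime the coded selection at a base is `par`. [cite: Balaban1985BackgroundPropagators, (3.35) p.396, bookkeeping] -/
theorem parSelC_base_of_inRegY {U : CfgY 𝔸 i} (h : InRegY G i par U) : parSelC G i par (.base U) = par := selY_of_inRegY G i par h

/-- on the regime the coded selection at a product is `par`. [cite: Balaban1985BackgroundPropagators, Thm 3.4 p.400, bookkeeping] -/
theorem parSelC_prod_of_inRegY {U : CfgY 𝔸 i} (h : InRegY G i par U) (a : AfldY 𝔸 i) : parSelC G i par (.prod U a) = par :=
  selY_of_inRegY G i par h

/-- the regime from a GUARDED membership law: if `U` is `G`-valued and the law gives `par U` `G`-valued, `U` is in the regime (the form in which the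
frame constructors use their guarded display `hparG`∕`hparC`). [cite: Balaban1985BackgroundPropagators, (3.35) p.396, bookkeeping] -/
theorem inRegY_of (U : CfgY 𝔸 i) (hU : GVal G i U) (hmem : ∀ z w, par U z w ∈ G) : InRegY G i par U := ⟨hU, hmem⟩

/-! ## §2 Membership and reversal of the selected transporter -/

/-- **the selected transporter is `G`-valued AT ITS OWN configuration** — unconditionally (on the regime by the regime, off it because `1 ∈ G`).
[cite: Balaban1985BackgroundPropagators, (3.35) p.396, (3.21) p.394] -/
theorem selY_mem (U : CfgY 𝔸 i) (z w : SiteY i) : selY G i par U U z w ∈ G := by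
  by_cases h : InRegY G i par U
  · rw [selY_of_inRegY G i par h]; exact h.2 z w
  · rw [selY_of_not_inRegY G i par h]; exact one_mem G

/-- the same for the coded selection at a base. [cite: Balaban1985BackgroundPropagators, (3.35) p.396, (3.21) p.394] -/
theorem parSelC_mem_base (U : CfgY 𝔸 i) (z w : SiteY i) : parSelC G i par (.base U) U z w ∈ G :=
  selY_mem G i par U z w

/-- the identity transporter is `G`-valued everywhere. [cite: Balaban1985BackgroundPropagators, (3.21) p.394, bookkeeping] -/
theorem parOneY_mem (U : CfgY 𝔸 i) (z w : SiteY i) : parOneY i U z w ∈ G := one_mem G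

/-- the identity transporter satisfies the reversal law `U(Γ_{z,w}) = U(Γ_{w,z})⁻¹`. [cite: Balaban1985BackgroundPropagators, (3.21) p.394, bookkeeping] -/
theorem parOneY_symm (U : CfgY 𝔸 i) (z w : SiteY i) : parOneY i U z w = (parOneY i U w z)⁻¹ := by
  simp [parOneY]

/-- **the selected transporter inherits the reversal law** `U(Γ_{z,w}) = U(Γ_{w,z})⁻¹` (at every configuration) from `par`.
[cite: Balaban1985BackgroundPropagators, (3.21) p.394 (contours and their reverses)] -/
theorem selY_symm (hsym : ∀ (U : CfgY 𝔸 i) (z w : SiteY i), par U z w = (par U w z)⁻¹) (U V : CfgY 𝔸 i) (z w : SiteY i) :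
    selY G i par U V z w = (selY G i par U V w z)⁻¹ := by
  by_cases h : InRegY G i par U
  · rw [selY_of_inRegY G i par h]; exact hsym V z w
  · rw [selY_of_not_inRegY G i par h]; exact parOneY_symm i V z w

/-- the same for the coded selection, at every coded configuration. [cite: Balaban1985BackgroundPropagators, (3.21) p.394, bookkeeping] -/
theorem parSelC_symm (hsym : ∀ (U : CfgY 𝔸 i) (z w : SiteY i), par U z w = (par U w z)⁻¹) (c : CCfg (CfgY 𝔸 i) (AfldY 𝔸 i))
    (V : CfgY 𝔸 i) (z w : SiteY i) : parSelC G i par c V z w = (parSelC G i par c V w z)⁻¹ := by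
  match c with
  | .base U => exact selY_symm G i par hsym U V z w
  | .mult _ => exact hsym V z w
  | .prod U _ => exact selY_symm G i par hsym U V z w

/-! ## §3 The root frame's (3.19)∕(3.24) size fields at the selected transporter — at EVERY coded configuration -/

/-- ★ FIELD `hkQ` AT THE SELECTED TRANSPORTER, UNCONDITIONALLY: `‖kQ(c; b, w)‖ ≦ W_{s(b)}⁻¹` at every coded configuration `c`, the letter read at the
selected transporter of `c` (genuine `G`-valued transports at a base in the regime, identity transports at a `G`-valued base off it, the letter `0`
elsewhere) — for `G` with elements of norm `≦ 1`. [cite: Balaban1985BackgroundPropagators, (3.19) p.393, (3.35) p.396] -/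
theorem kQC_norm_le_sel (hG1 : ∀ u : 𝔸ˣ, u ∈ G → ‖(u : 𝔸)‖ ≤ 1) (c : CCfg (CfgY 𝔸 i) (AfldY 𝔸 i)) (bnd : IBondY i) (w : SiteY i) :
    ‖kQC G i (parSelC G i par c) c bnd w‖ ≤ wC i c bnd := by
  classical
  have h0 : ‖(0 : 𝔸 →L[ℝ] 𝔸)‖ ≤ wC i c bnd := by rw [norm_zero]; exact wC_nonneg i c bnd
  match c with
  | .base U =>
    by_cases hU : GVal G i U
    · simp only [kQC, if_pos hU, wC, parSelC]
      exact norm_kQY_le i (selY G i par U) U _ w (norm_le_one_and_inv_of_mem G hG1 (selY_mem G i par U _ _))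
    · simp only [kQC, if_neg hU]; exact h0
  | .mult _ => exact h0
  | .prod _ _ => exact h0

/-- ★ FIELD `hsQ` AT THE SELECTED TRANSPORTER, UNCONDITIONALLY: `‖sQ(c; z)‖ ≦ 1` at every coded configuration. [cite: Balaban1985BackgroundPropagators, (3.24) p.394, (3.35) p.396] -/
theorem sQC_norm_le_sel (hG1 : ∀ u : 𝔸ˣ, u ∈ G → ‖(u : 𝔸)‖ ≤ 1) (c : CCfg (CfgY 𝔸 i) (AfldY 𝔸 i)) (z : SiteY i) :
    ‖sQC G i (parSelC G i par c) c z‖ ≤ 1 := by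
  classical
  have h0 : ‖(0 : 𝔸 →L[ℝ] 𝔸)‖ ≤ 1 := by rw [norm_zero]; exact zero_le_one
  match c with
  | .base U =>
    by_cases hU : GVal G i U
    · simp only [sQC, if_pos hU, parSelC]
      exact norm_sQY_le i (selY G i par U) U z (norm_le_one_and_inv_of_mem G hG1 (selY_mem G i par U _ _))
    · simp only [sQC, if_neg hU]; exact h0
  | .mult _ => exact h0
  | .prod _ _ => exact h0

end Literature.MathematicalPhysics.QuantumFieldTheory.Balaban1983to89.B9SectBParSelY
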